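import Summits.NavierStokesRegularity.NavierStokesRegularity.Theorems.LerayQuarterDissipationQuarterDeck
import Summits.NavierStokesRegularity.NavierStokesRegularity.Theorems.TypeIQuarterGateQuarterLawTypeIIffUniformCount
import HarnessLib

/-!
# Shelf 1574 in the COUNT currency: `EnstrophyQuarterLaw ↔ NoTypeII ∧ UniformConcentrationCountTypeI`

Helper file (`--supports stmt-NavierStokesRegularity-1574`). The tree already certifies
`EnstrophyQuarterLaw (1574) ↔ NoTypeII (0056) ∧ QuarterLawTypeI (23726)`
(`QuarterDeck.enstrophyQuarterLaw_iff_noTypeII_and_quarterLawTypeI`); with the equivalence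
`QuarterLawTypeI ↔ UniformConcentrationCountTypeI` (`CountQuarterLaw.quarterLawTypeI_iff_uniformConcentrationCountTypeI`,
this seat) the quarter-law shelf gets a fifth, GAUGE-FREE residual currency on the Type-I stratum: the
scale-uniform ε-concentration COUNT of dissipating vertex-`T` cylinders (printed-adjacent to Barker 2024 Thm 3 /
Choe–Wolf–Yang 2018 under `L^{3,∞}`): `EnstrophyQuarterLaw ↔ NoTypeII ∧ UniformConcentrationCountTypeI`.
HONEST FRAMING: an equivalence of OPEN statements; none is asserted; NS regularity untouched. [folklore]
-/

-- the problem directory repeats the summit name (`NavierStokesRegularity/NavierStokesRegularity`)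
set_option linter.dupNamespace false

namespace Summit.NavierStokesRegularity.NavierStokesRegularity.Theorems.CountQuarterLaw

/-- **`EnstrophyQuarterLaw ↔ NoTypeII ∧ UniformConcentrationCountTypeI`** (shelf 1574 ≡ the Type-I wall
0056 ∧ the scale-uniform ε-concentration count 23970). Equivalence of open statements. [folklore] -/
theorem enstrophyQuarterLaw_iff_noTypeII_and_uniformConcentrationCountTypeI :
    Summit.NavierStokesRegularity.NavierStokesRegularity.Theses.LerayQuarterDissipation.EnstrophyQuarterLaw ↔
      (Summit.NavierStokesRegularity.NavierStokesRegularity.Theses.TypeIQuarterGate.NoTypeII ∧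
        Summit.NavierStokesRegularity.NavierStokesRegularity.Theses.TypeIQuarterGate.UniformConcentrationCountTypeI) := by
  rw [QuarterDeck.enstrophyQuarterLaw_iff_noTypeII_and_quarterLawTypeI,
    quarterLawTypeI_iff_uniformConcentrationCountTypeI]

end Summit.NavierStokesRegularity.NavierStokesRegularity.Theorems.CountQuarterLaw
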